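import Summits.ValiantsHypothesis.ValiantsHypothesis.Theorems.KPlusLogSqLawTropicalBColumnFanoutWalks
import Summits.ValiantsHypothesis.ValiantsHypothesis.Theorems.KPlusLogSqLawTropicalBColumnFanoutEntries

/-!
# Route `KPlusLogSqLaw`, crux `TropicalB` (stmt-ValiantsHypothesis-19771) — the column fan-out PER DESIGN (existential form with
# row-degree control), the reusable API of `…TropicalBColumnFanout`

HONEST FRAMING.  Helper file (seat val-sym-trop-p1 g16, cell `pub-symmetroid`, 2026-08-28) toward the registered stubs `stub_tropThin` /
`stub_tropFat` of `Cruxes/TropicalB/Lines/birth.lean` (crux `Summit.ValiantsHypothesis.ValiantsHypothesis.Theses.KPlusLogSqLaw.TropicalB`,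
item `stmt-ValiantsHypothesis-19771`, route `KPlusLogSqLaw`; `--supports … --as helper`).  Re-packaging of the column fan-out gadget of
`…TropicalBColumnFanout` (p594963, seat val-sym-trop-p1 g14; its `ColumnFanout.tropRowD_of_degreeThree` is the class-level corollary) as a
statement about ONE design, with the extra bookkeeping that ROW degrees do not grow: an original row `s` keeps exactly its present entries
(as the exit rows of the columns `(j, s+1)`), and a decision row `(j, s+1)` is present in the two columns `(j, s)`, `(j, s+1)` only.  Made to
be composed (`…TropicalBTranspose`, `…TropicalBOneCutLift`): fan out, transpose, fan out again gives supports with ALL row and column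
degrees `≤ 3`.  It bounds nothing for `TropicalB` and bears on neither `WeakLifting`, the doors, `MatrixDescartes` (stmt-ValiantsHypothesis-18050)
nor VP ≠ VNP.

* `exists_fanout_lift` — for every design `(d, v, ε)` of format `(m, K)` there is a design `(d', v', ε')` of format `(m(m+1), K+1)` with
  (a) at most three present rows in every column, (b) at most `max r 2` present entries in every row whenever every row of `ε` has at most
  `r`, (c) `DesignRowD d' v' ε' B → DesignRowD d v ε B` for every `B`.
The construction and the dominance transfer are verbatim those of `…TropicalBColumnFanout` (see its header for the dictionary).  [folklore]
-/

set_option linter.dupNamespace false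
set_option autoImplicit false

namespace Summit.ValiantsHypothesis.ValiantsHypothesis.Theorems.KPlusLogSqLaw

open Summit.ValiantsHypothesis.ValiantsHypothesis.Theorems.MatrixDescartes.Negative
open Summit.ValiantsHypothesis.ValiantsHypothesis.Theorems.LacunarySymmetroidMatrixDescartes
open scoped BigOperators
open Finset

namespace ColumnFanout

variable {m K : ℕ}

/-- **The column fan-out of a design** (existential form of `tropRowD_of_degreeThree`, with ROW-DEGREE CONTROL): a design of format
`(m(m+1), K+1)` with at most three present rows per column, whose rows have at most `max r 2` present entries whenever the rows of the
original design have at most `r`, and whose unsigned row bounds transfer down. [folklore] (gadget of `…TropicalBColumnFanout`) -/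
theorem exists_fanout_lift (m K : ℕ) (d : Fin K → ℕ) (v ε : Fin m → Fin m → Fin K → ℤ) :
    ∃ (d' : Fin (K + 1) → ℕ) (v' ε' : Fin (m * (m + 1)) → Fin (m * (m + 1)) → Fin (K + 1) → ℤ),
      (∀ c, (Finset.univ.filter fun r => ∃ l, ε' r c l ≠ 0).card ≤ 3) ∧
      (∀ r : ℕ, (∀ a : Fin m, (Finset.univ.filter fun b => ∃ l, ε a b l ≠ 0).card ≤ r) →
        ∀ x, (Finset.univ.filter fun y => ∃ l, ε' x y l ≠ 0).card ≤ max r 2) ∧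
      (∀ B : ℕ, DesignRowD d' v' ε' B → DesignRowD d v ε B) := by
  classical
  -- the structured index type and its transport
  set e : Fin m × Fin (m + 1) ≃ Fin (m * (m + 1)) := finProdFinEquiv with he
  -- the fan-out design on the structured index type
  obtain ⟨E, hE⟩ : ∃ E : Fin m × Fin (m + 1) → Fin m × Fin (m + 1) → Fin (K + 1) → ℤ, ∀ r c l, E r c l =
      (if (c.2 : ℕ) = 0 then (if r.1 = c.1 ∧ (r.2 : ℕ) = 1 ∧ l = Fin.last K then 1 else 0)
       else if (r.2 : ℕ) = 0 ∧ (r.1 : ℕ) + 1 = (c.2 : ℕ) then (if h : (l : ℕ) < K then ε r.1 c.1 ⟨l, h⟩ else 0)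
       else if r.1 = c.1 ∧ (r.2 : ℕ) = (c.2 : ℕ) + 1 ∧ l = Fin.last K then 1
       else if r = c ∧ l = Fin.last K then 1 else 0) := ⟨_, fun _ _ _ => rfl⟩
  obtain ⟨V, hV⟩ : ∃ V : Fin m × Fin (m + 1) → Fin m × Fin (m + 1) → Fin (K + 1) → ℤ, ∀ r c l, V r c l =
      (if h : (c.2 : ℕ) ≠ 0 ∧ (r.2 : ℕ) = 0 ∧ (r.1 : ℕ) + 1 = (c.2 : ℕ) ∧ (l : ℕ) < K then v r.1 c.1 ⟨l, h.2.2.2⟩ else 0) :=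
    ⟨_, fun _ _ _ => rfl⟩
  obtain ⟨D, hD⟩ : ∃ D : Fin (K + 1) → ℕ, ∀ l, D l = if h : (l : ℕ) < K then d ⟨l, h⟩ else 0 := ⟨_, fun _ => rfl⟩
  have hDcast : ∀ l : Fin K, D (Fin.castSucc l) = d l := by
    intro l; rw [hD, dif_pos (by simp)]; rfl
  have hDlast : D (Fin.last K) = 0 := by rw [hD, dif_neg (by simp)]
  -- the transported design
  let ε' : Fin (m * (m + 1)) → Fin (m * (m + 1)) → Fin (K + 1) → ℤ := fun x y l => E (e.symm x) (e.symm y) l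
  let v' : Fin (m * (m + 1)) → Fin (m * (m + 1)) → Fin (K + 1) → ℤ := fun x y l => V (e.symm x) (e.symm y) l
  -- (i) column degree ≤ 3
  have hdeg : ∀ y, (Finset.univ.filter fun x => ∃ l, ε' x y l ≠ 0).card ≤ 3 := by
    intro y
    set c := e.symm y with hc
    have hmpos : 0 < m := by have := c.1.isLt; omega
    -- three candidate rows
    let r1 : Fin m × Fin (m + 1) := (⟨((c.2 : ℕ) - 1) % m, Nat.mod_lt _ hmpos⟩, 0)
    let r2 : Fin m × Fin (m + 1) := (c.1, ⟨((c.2 : ℕ) + 1) % (m + 1), Nat.mod_lt _ (Nat.succ_pos m)⟩)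
    let r3 : Fin m × Fin (m + 1) := c
    have hsub : (Finset.univ.filter fun x => ∃ l, ε' x y l ≠ 0) ⊆ ({e r1, e r2, e r3} : Finset _) := by
      intro x hx
      rw [Finset.mem_filter] at hx
      obtain ⟨l, hl⟩ := hx.2
      have hl' : E (e.symm x) c l ≠ 0 := by simpa [ε', hc] using hl
      rw [Finset.mem_insert, Finset.mem_insert, Finset.mem_singleton]
      have hx' : x = e (e.symm x) := (Equiv.apply_symm_apply e x).symm
      rcases cases_of_E ε E hE (e.symm x) c l hl' with ⟨h0, h1, h2, _⟩ | ⟨h0, h1, h2, _⟩ | ⟨h0, h1, h2, _⟩ | ⟨_, h1, _⟩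
      · right; left; rw [hx']; congr 1
        refine Prod.ext h1 (Fin.ext ?_)
        show ((e.symm x).2 : ℕ) = ((c.2 : ℕ) + 1) % (m + 1)
        rw [h0, h2]; exact (Nat.mod_eq_of_lt (by omega)).symm
      · left; rw [hx']; congr 1
        refine Prod.ext (Fin.ext ?_) (Fin.ext ?_)
        · show ((e.symm x).1 : ℕ) = ((c.2 : ℕ) - 1) % m
          have : ((e.symm x).1 : ℕ) < m := (e.symm x).1.isLt
          rw [Nat.mod_eq_of_lt (by omega)]; omega
        · show ((e.symm x).2 : ℕ) = 0
          exact h1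
      · right; left; rw [hx']; congr 1
        refine Prod.ext h1 (Fin.ext ?_)
        show ((e.symm x).2 : ℕ) = ((c.2 : ℕ) + 1) % (m + 1)
        have : ((e.symm x).2 : ℕ) < m + 1 := (e.symm x).2.isLt
        rw [Nat.mod_eq_of_lt (by omega)]; exact h2
      · right; right; rw [hx', h1]
    calc (Finset.univ.filter fun x => ∃ l, ε' x y l ≠ 0).card ≤ ({e r1, e r2, e r3} : Finset _).card :=
          Finset.card_le_card hsub
      _ ≤ 3 := by
          refine (Finset.card_insert_le _ _).trans ?_
          refine (Nat.add_le_add_right (Finset.card_insert_le _ _) 1).trans ?_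
          simp
  -- (ii) the walks: for every original permutation, its structured walk permutation
  have hdesc := fun σ : Equiv.Perm (Fin m) => desc_exists σ
  choose W hW using hdesc
  -- the class map of a term
  let L : (Equiv.Perm (Fin m) × (Fin m → Fin K)) → Fin m × Fin (m + 1) → Fin (K + 1) := fun q c =>
    if (c.2 : ℕ) = (q.1 c.1 : ℕ) + 1 then Fin.castSucc (q.2 c.1) else Fin.last K
  -- the big term of `q`
  let T : (Equiv.Perm (Fin m) × (Fin m → Fin K)) → Equiv.Perm (Fin (m * (m + 1))) × (Fin (m * (m + 1)) → Fin (K + 1)) :=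
    fun q => (e.permCongr (W q.1), fun y => L q (e.symm y))
  -- (iii) entries picked up by the big term of `q`
  have hentries : ∀ (q : Equiv.Perm (Fin m) × (Fin m → Fin K)) (j : Fin m) (t : Fin (m + 1)),
      (E (W q.1 (j, t)) (j, t) (L q (j, t)) = if (t : ℕ) = (q.1 j : ℕ) + 1 then ε (q.1 j) j (q.2 j) else 1) ∧
      (V (W q.1 (j, t)) (j, t) (L q (j, t)) = if (t : ℕ) = (q.1 j : ℕ) + 1 then v (q.1 j) j (q.2 j) else 0) := by
    intro q j t
    obtain ⟨a0, a1, a2, a3⟩ := hW q.1 j t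
    have hL : L q (j, t) = if (t : ℕ) = (q.1 j : ℕ) + 1 then Fin.castSucc (q.2 j) else Fin.last K := rfl
    by_cases ht : (t : ℕ) = (q.1 j : ℕ) + 1
    · -- exit column
      rw [hL, if_pos ht, if_pos ht, if_pos ht, a2 ht]
      exact ⟨E_exit ε E hE j (q.1 j) t 0 ht (by simp) (q.2 j), V_exit v V hV j (q.1 j) t 0 ht (by simp) (q.2 j)⟩
    · rw [hL, if_neg ht, if_neg ht, if_neg ht]
      refine ⟨?_, V_last v V hV _ _⟩
      by_cases h0 : (t : ℕ) = 0
      · obtain ⟨x1, x2⟩ := a0 h0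
        have hw : W q.1 (j, t) = (j, (W q.1 (j, t)).2) := Prod.ext x1 rfl
        rw [hw]
        exact E_start ε E hE j t _ h0 x2
      · by_cases h1 : (t : ℕ) ≤ (q.1 j : ℕ)
        · obtain ⟨x1, x2⟩ := a1 h0 h1
          have hw : W q.1 (j, t) = (j, (W q.1 (j, t)).2) := Prod.ext x1 rfl
          rw [hw]
          exact E_cont ε E hE j t _ h0 x2
        · have h3 : (q.1 j : ℕ) + 1 < (t : ℕ) := by omega
          rw [a3 h3]
          exact E_idle ε E hE j t h0
  -- (iv) presence and weight of the big term
  have hpres : ∀ q : Equiv.Perm (Fin m) × (Fin m → Fin K), termSign ε q ≠ 0 → termSign ε' (T q) ≠ 0 := by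
    intro q hq
    rw [termSign_ne_zero_iff]
    intro y
    have hq' := (termSign_ne_zero_iff ε q).1 hq
    show E (e.symm ((e.permCongr (W q.1)) y)) (e.symm y) (L q (e.symm y)) ≠ 0
    rw [Equiv.permCongr_apply, Equiv.symm_apply_apply]
    obtain ⟨j, t⟩ := e.symm y
    rw [(hentries q j t).1]
    split_ifs
    · exact hq' j
    · exact one_ne_zero
  have hweight : ∀ (q : Equiv.Perm (Fin m) × (Fin m → Fin K)) (θ₀ : ℤ),
      tropWeight D v' θ₀ (T q) = tropWeight d v θ₀ q := by
    intro q θ₀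
    unfold tropWeight
    have hs1 : ∑ y : Fin (m * (m + 1)), (D ((T q).2 y) : ℤ) = ∑ i : Fin m, (d (q.2 i) : ℤ) := by
      show ∑ y, (D (L q (e.symm y)) : ℤ) = _
      rw [← Equiv.sum_comp e (fun y => (D (L q (e.symm y)) : ℤ))]
      simp only [Equiv.symm_apply_apply]
      rw [Fintype.sum_prod_type]
      refine Finset.sum_congr rfl fun j _ => ?_
      rw [Finset.sum_eq_single ⟨(q.1 j : ℕ) + 1, by omega⟩]
      · have : L q (j, ⟨(q.1 j : ℕ) + 1, by omega⟩) = Fin.castSucc (q.2 j) := if_pos rfl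
        rw [this, hDcast]
      · intro t _ ht
        have : L q (j, t) = Fin.last K := by
          refine if_neg ?_
          intro hh; exact ht (Fin.ext hh)
        rw [this, hDlast]; simp
      · intro hh; exact absurd (Finset.mem_univ _) hh
    have hs2 : ∑ y : Fin (m * (m + 1)), v' ((T q).1 y) y ((T q).2 y) = ∑ i : Fin m, v (q.1 i) i (q.2 i) := by
      show ∑ y, V (e.symm ((e.permCongr (W q.1)) y)) (e.symm y) (L q (e.symm y)) = _
      rw [← Equiv.sum_comp e (fun y => V (e.symm ((e.permCongr (W q.1)) y)) (e.symm y) (L q (e.symm y)))]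
      simp only [Equiv.permCongr_apply, Equiv.symm_apply_apply]
      rw [Fintype.sum_prod_type]
      refine Finset.sum_congr rfl fun j _ => ?_
      rw [Finset.sum_eq_single ⟨(q.1 j : ℕ) + 1, by omega⟩]
      · rw [(hentries q j _).2, if_pos rfl]
      · intro t _ ht
        rw [(hentries q j t).2, if_neg]
        intro hh; exact ht (Fin.ext hh)
      · intro hh; exact absurd (Finset.mem_univ _) hh
    rw [hs1, hs2]
  -- (v) every present big term is a big term of a present original term
  have hsurj : ∀ Q : Equiv.Perm (Fin (m * (m + 1))) × (Fin (m * (m + 1)) → Fin (K + 1)),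
      termSign ε' Q ≠ 0 → ∃ q, termSign ε q ≠ 0 ∧ T q = Q := by
    intro Q hQ
    have hQ' := (termSign_ne_zero_iff ε' Q).1 hQ
    set S : Equiv.Perm (Fin m × Fin (m + 1)) := e.symm.permCongr Q.1 with hS
    set Lc : Fin m × Fin (m + 1) → Fin (K + 1) := fun u => Q.2 (e u) with hLc
    have hSu : ∀ u, S u = e.symm (Q.1 (e u)) := by
      intro u; rw [hS, Equiv.permCongr_apply, Equiv.symm_symm]
    have hpresu : ∀ u, E (S u) u (Lc u) ≠ 0 := by
      intro u
      have := hQ' (e u)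
      change E (e.symm (Q.1 (e u))) (e.symm (e u)) (Q.2 (e u)) ≠ 0 at this
      rw [Equiv.symm_apply_apply] at this
      rw [hSu]; exact this
    have hc := fun u => cases_of_E ε E hE (S u) u (Lc u) (hpresu u)
    have hcase : ∀ c : Fin m × Fin (m + 1),
        ((c.2 : ℕ) = 0 ∧ (S c).1 = c.1 ∧ ((S c).2 : ℕ) = 1) ∨
        ((c.2 : ℕ) ≠ 0 ∧ ((S c).2 : ℕ) = 0 ∧ ((S c).1 : ℕ) + 1 = (c.2 : ℕ)) ∨
        ((c.2 : ℕ) ≠ 0 ∧ (S c).1 = c.1 ∧ ((S c).2 : ℕ) = (c.2 : ℕ) + 1) ∨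
        ((c.2 : ℕ) ≠ 0 ∧ S c = c) := by
      intro c
      rcases hc c with ⟨h0, h1, h2, _⟩ | ⟨h0, h1, h2, _⟩ | ⟨h0, h1, h2, _⟩ | ⟨h0, h1, _⟩
      · exact Or.inl ⟨h0, h1, h2⟩
      · exact Or.inr (Or.inl ⟨h0, h1, h2⟩)
      · exact Or.inr (Or.inr (Or.inl ⟨h0, h1, h2⟩))
      · exact Or.inr (Or.inr (Or.inr ⟨h0, h1⟩))
    obtain ⟨σ, hσ⟩ := structure_of_cases S hcase
    -- classes at the exit columns
    have hexitcls : ∀ j : Fin m, ∃ l : Fin K, Fin.castSucc l = Lc (j, ⟨(σ j : ℕ) + 1, by omega⟩) ∧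
        ε (σ j) j l ≠ 0 := by
      intro j
      set t : Fin (m + 1) := ⟨(σ j : ℕ) + 1, by omega⟩ with ht
      have hx : S (j, t) = (σ j, 0) := (hσ j t).2.2.1 (by simp [ht])
      rcases hc (j, t) with ⟨h0, _⟩ | ⟨_, _, h2, hl, hε⟩ | ⟨_, _, h2, _⟩ | ⟨_, h1, _⟩
      · simp [ht] at h0
      · rw [hx] at hε
        exact ⟨⟨_, hl⟩, Fin.ext rfl, hε⟩
      · rw [hx] at h2; simp [ht] at h2
      · rw [hx] at h1
        have := congrArg (fun x => ((x.2 : Fin (m + 1)) : ℕ)) h1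
        simp [ht] at this
    choose lam hlam using hexitcls
    refine ⟨(σ, lam), ?_, ?_⟩
    · rw [termSign_ne_zero_iff]
      intro j; exact (hlam j).2
    · -- `T (σ, lam) = Q`
      have hWS : W σ = S := desc_unique (hW σ) hσ
      refine Prod.ext ?_ ?_
      · -- permutations
        ext y : 1
        show (e.permCongr (W σ)) y = Q.1 y
        rw [Equiv.permCongr_apply, hWS, hSu, Equiv.apply_symm_apply, Equiv.apply_symm_apply]
      · funext y
        show L (σ, lam) (e.symm y) = Q.2 y
        have hy : Q.2 y = Lc (e.symm y) := by rw [hLc]; simp only; rw [Equiv.apply_symm_apply]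
        rw [hy]
        obtain ⟨j, t⟩ := e.symm y
        show (if (t : ℕ) = (σ j : ℕ) + 1 then Fin.castSucc (lam j) else Fin.last K) = Lc (j, t)
        by_cases hjt : (t : ℕ) = (σ j : ℕ) + 1
        · rw [if_pos hjt]
          have : t = ⟨(σ j : ℕ) + 1, by omega⟩ := Fin.ext hjt
          rw [this]
          exact (hlam j).1
        · rw [if_neg hjt]
          obtain ⟨a0, a1, a2, a3⟩ := hσ j t
          rcases hc (j, t) with ⟨_, _, _, hl⟩ | ⟨h0, h1, h2, _⟩ | ⟨_, _, _, hl⟩ | ⟨_, _, hl⟩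
          · exact hl.symm
          · -- an exit column must be the exit of the walk
            exfalso
            by_cases ht0 : (t : ℕ) = 0
            · exact h0 ht0
            by_cases ht1 : (t : ℕ) ≤ (σ j : ℕ)
            · have := (a1 ht0 ht1).2; omega
            · have h3 : (σ j : ℕ) + 1 < (t : ℕ) := by omega
              have := a3 h3
              rw [this] at h1
              exact ht0 h1
          · exact hl.symm
          · exact hl.symm
  -- (vi) row degrees: an original row keeps its degree (exit entries only), a decision row has two present entries
  have hrowdeg : ∀ r : ℕ, (∀ a : Fin m, (Finset.univ.filter fun b => ∃ l, ε a b l ≠ 0).card ≤ r) →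
      ∀ x, (Finset.univ.filter fun y => ∃ l, ε' x y l ≠ 0).card ≤ max r 2 := by
    intro r hr x
    set u := e.symm x with hu
    have hx : x = e u := by rw [hu, Equiv.apply_symm_apply]
    by_cases hu0 : (u.2 : ℕ) = 0
    · -- original row: its present entries are the exit entries of the columns `(j, u.1 + 1)` with `(u.1, j)` present
      refine le_trans ?_ ((hr u.1).trans (le_max_left r 2))
      refine Finset.card_le_card_of_injOn (fun y => (e.symm y).1) ?_ ?_
      · intro y hy
        rw [Finset.mem_coe, Finset.mem_filter] at hy
        obtain ⟨l, hl⟩ := hy.2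
        have hl' : E u (e.symm y) l ≠ 0 := by simpa [ε', hu] using hl
        rw [Finset.mem_coe, Finset.mem_filter]
        rcases cases_of_E ε E hE u (e.symm y) l hl' with ⟨_, _, h2, _⟩ | ⟨_, _, _, hl2, hε⟩ | ⟨_, _, h2, _⟩ | ⟨h0, h1, _⟩
        · omega
        · exact ⟨Finset.mem_univ _, ⟨(l : ℕ), hl2⟩, hε⟩
        · omega
        · exfalso; apply h0; rw [← h1]; exact hu0
      · intro y hy y' hy' hyy
        rw [Finset.mem_coe, Finset.mem_filter] at hy hy'
        obtain ⟨l, hl⟩ := hy.2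
        obtain ⟨l', hl'⟩ := hy'.2
        have hl1 : E u (e.symm y) l ≠ 0 := by simpa [ε', hu] using hl
        have hl2 : E u (e.symm y') l' ≠ 0 := by simpa [ε', hu] using hl'
        have hsec : ∀ (z : Fin (m * (m + 1))) (l₀ : Fin (K + 1)), E u (e.symm z) l₀ ≠ 0 → ((e.symm z).2 : ℕ) = (u.1 : ℕ) + 1 := by
          intro z l₀ hz
          rcases cases_of_E ε E hE u (e.symm z) l₀ hz with ⟨_, _, h2, _⟩ | ⟨_, _, h3, _⟩ | ⟨_, _, h2, _⟩ | ⟨h0, h1, _⟩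
          · omega
          · exact h3.symm
          · omega
          · exfalso; apply h0; rw [← h1]; exact hu0
        apply e.symm.injective
        exact Prod.ext hyy (Fin.ext ((hsec y l hl1).trans (hsec y' l' hl2).symm))
    · -- decision row `(j, s+1)`: present only in the columns `(j, s)` and `(j, s+1)`
      refine le_trans ?_ (le_max_right r 2)
      have hlt : (u.2 : ℕ) - 1 < m + 1 := by have := u.2.isLt; omega
      have hsub : (Finset.univ.filter fun y => ∃ l, ε' x y l ≠ 0) ⊆
          ({e (u.1, ⟨(u.2 : ℕ) - 1, hlt⟩), e u} : Finset _) := by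
        intro y hy
        rw [Finset.mem_filter] at hy
        obtain ⟨l, hl⟩ := hy.2
        have hl' : E u (e.symm y) l ≠ 0 := by simpa [ε', hu] using hl
        rw [Finset.mem_insert, Finset.mem_singleton]
        have hy' : y = e (e.symm y) := (Equiv.apply_symm_apply e y).symm
        rcases cases_of_E ε E hE u (e.symm y) l hl' with ⟨h0, h1, h2, _⟩ | ⟨_, h1, _⟩ | ⟨_, h1, h2, _⟩ | ⟨_, h1, _⟩
        · left; rw [hy']; congr 1
          exact Prod.ext h1.symm (Fin.ext (by simp only; omega))
        · exact absurd h1 hu0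
        · left; rw [hy']; congr 1
          exact Prod.ext h1.symm (Fin.ext (by simp only; omega))
        · right; rw [hy', h1]
      calc (Finset.univ.filter fun y => ∃ l, ε' x y l ≠ 0).card
          ≤ ({e (u.1, ⟨(u.2 : ℕ) - 1, hlt⟩), e u} : Finset _).card := Finset.card_le_card hsub
        _ ≤ 2 := by refine (Finset.card_insert_le _ _).trans ?_; simp
  -- (vii) the lift and the transfer of row bounds
  refine ⟨D, v', ε', hdeg, hrowdeg, fun B hrow n θ p hθ hdom hstep => ?_⟩
  refine hrow n θ (fun k => T (p k)) hθ ?_ ?_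
  · intro k
    refine ⟨hpres (p k) (hdom k).1, fun Q hne hQ => ?_⟩
    obtain ⟨q, hq, rfl⟩ := hsurj Q hQ
    have hne' : q ≠ p k := fun hh => hne (by rw [hh])
    rw [hweight, hweight]
    exact (hdom k).2 q hne' hq
  · -- consecutive big terms are distinct: the exit permutation and the exit classes are recovered
    intro k hk
    apply hstep k
    have h1 : W (p k.castSucc).1 = W (p k.succ).1 := by
      have := congrArg Prod.fst hk
      simp only [T] at this
      exact (Equiv.permCongr e).injective this
    have hσeq : (p k.castSucc).1 = (p k.succ).1 :=
      sigma_unique (hW (p k.castSucc).1) (by rw [h1]; exact hW (p k.succ).1)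
    have h2 : ∀ y, L (p k.castSucc) (e.symm y) = L (p k.succ) (e.symm y) := fun y => by
      have := congrArg Prod.snd hk
      exact congrFun this y
    refine Prod.ext hσeq (funext fun j => ?_)
    have hj := h2 (e (j, ⟨((p k.castSucc).1 j : ℕ) + 1, by omega⟩))
    rw [Equiv.symm_apply_apply] at hj
    have e1 : L (p k.castSucc) (j, ⟨((p k.castSucc).1 j : ℕ) + 1, by omega⟩) = Fin.castSucc ((p k.castSucc).2 j) :=
      if_pos rfl
    have e2 : L (p k.succ) (j, ⟨((p k.castSucc).1 j : ℕ) + 1, by omega⟩) = Fin.castSucc ((p k.succ).2 j) := by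
      refine if_pos ?_
      show ((p k.castSucc).1 j : ℕ) + 1 = ((p k.succ).1 j : ℕ) + 1
      rw [hσeq]
    rw [e1, e2] at hj
    exact Fin.castSucc_injective _ hj

end ColumnFanout

end Summit.ValiantsHypothesis.ValiantsHypothesis.Theorems.KPlusLogSqLaw
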